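import Summits.CriticalPhenomena.PercolationContinuityZ3.Theorems.PercNearOneGluingNoHeavyLowerTailAPLTwoSidedReduction
import HarnessLib

/-!
# `NoHeavyLowerTail` (stmt-CriticalPhenomena-4575) — TWO-SIDED PARALLEL COMPOSITION II: pendant apex edges in cell form and
`E ≤ 28/27` under composition with any Harris-tight piece

Support file (prover prim-ineq-gen-8 gen 60; `--supports stmt-CriticalPhenomena-4575`; memo
run/shared/lean/prim/prim-ineq-gen-8/FINDING-gen60-TWOSIDED.md).  No definitions, no named facts, no sorries.  Notation as in
`…APLTwoSidedReduction.lean`: cells `(x₀, B, A, m, τ)`, `p = τ + B`, `π = τ + A`, `κ = τ − pπ`, `E = κ²/(pπm)`, `C = 28/27`.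
* `pendant_u_le`, `pendant_v_le` (+ `pendant_u_harris`, `pendant_v_harris`) — cell/real form of the apex-pendant step (an apex–port edge
  of probability `a` at `u`, resp. `b` at `v`; the instance of `series_real` with the degenerate port `c = u`): `E ≤ C` and Harris are
  preserved, `C ≥ 1`.
* **`harrisTight_comp_le`** — if `x` is Harris with `E ≤ 28/27` and `y` is ANY valid piece with `κ_y = 0` (equivalently
  `y = ((1−a)(1−b)(1−w), a(1−b), (1−a)b, (1−a)(1−b)w, ab)`: independent apex connections `a, b` and a `u–v` link of conditional
  probability `w` given `o` isolated), then the parallel composite has `E ≤ 28/27`.  Proof: the composite is obtained from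
  `((x ⊙ e_w) ⊙ e_{ou,a}) ⊙ e_{ov,b}` (`shortcut_cells_le`, then two pendant edges — all three preserve `E ≤ C`) by moving the masses
  `w(1−a)b·(x₀+A)` and `wa(1−b)·(x₀+B)` from the all-joined cell to the cells `ov`, `ou`; this move lowers `κ/p` and `κ/π` and keeps `m`
  (Harris of the composite by `comp_harris`).  This settles the face `κ_y = 0` of the two-sided composition problem U(28/27) of the memos;
  in the table form of gen 60 (`z = O_y·(x ⊙ e_w) + A_y·x^{ov} + B_y·x^{ou} + τ_y·e₃`) it is the case of an uncorrelated apex table. [this work]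
-/

namespace Summit.CriticalPhenomena.PercolationContinuityZ3.Theorems

namespace APL

/-- **Apex-pendant edge at the port `u`, cell/real form** (instance of `series_real` with the edge `{o,u}` as the piece `(o; u, c = u)`):
a piece with `p = P(o↔u)`, `π = P(o↔v)`, `τ`, `m`, Harris `pπ ≤ τ`, `E ≤ C` (`C ≥ 1`), composed in parallel with an apex–port edge `o–u` of
probability `a`, becomes `p′ = a + (1−a)p`, `π′ = π + m a`, `τ′ = aπ + (1−a)τ + m a`, `m′ = (1−a)m`, and still has `E ≤ C`. [this work] -/
theorem pendant_u_le (C p π τ m a : ℝ) (hC : 1 ≤ C) (hp : 0 ≤ p) (hp1 : p ≤ 1) (hπ : 0 ≤ π) (hm : 0 ≤ m)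
    (hk : p * π ≤ τ) (hE : (τ - p * π) ^ 2 ≤ C * p * π * m) (ha0 : 0 ≤ a) (ha1 : a ≤ 1) :
    (a * π + (1 - a) * τ + m * a - (a + (1 - a) * p) * (π + m * a)) ^ 2
      ≤ C * (a + (1 - a) * p) * (π + m * a) * ((1 - a) * m) := by
  have hk' : π * p ≤ τ := by rw [mul_comm]; exact hk
  have hE' : (τ - π * p) ^ 2 ≤ C * π * p * m := by
    have e1 : (τ - π * p) ^ 2 = (τ - p * π) ^ 2 := by ring
    have e2 : C * π * p * m = C * p * π * m := by ring
    rw [e1, e2]; exact hE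
  have hE1 : (a - a * a) ^ 2 ≤ C * a * a * (1 - a) := by
    have h1 : (a - a * a) ^ 2 = a * a * (1 - a) * (1 - a) := by ring
    have h0 : 0 ≤ a * a * (1 - a) := by have := sub_nonneg.2 ha1; positivity
    have h2 : a * a * (1 - a) * (1 - a) ≤ a * a * (1 - a) * C :=
      mul_le_mul_of_nonneg_left (by linarith) h0
    rw [h1]; linarith
  exact series_real C a a a (1 - a) π p τ m hC ha0 ha0 ha1 (sub_nonneg.2 ha1) hπ hp hp1 hm (by nlinarith) hk' hE1 hE'

/-- Harris is kept by the apex-pendant step at `u`: `τ′ − p′π′ = (1−a)·((τ − pπ) + a·m·(1−p)) ≥ 0`. [this work] -/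
theorem pendant_u_harris (p π τ m a : ℝ) (hp1 : p ≤ 1) (hm : 0 ≤ m) (hk : p * π ≤ τ) (ha0 : 0 ≤ a) (ha1 : a ≤ 1) :
    (a + (1 - a) * p) * (π + m * a) ≤ a * π + (1 - a) * τ + m * a := by
  have e : a * π + (1 - a) * τ + m * a - (a + (1 - a) * p) * (π + m * a) = (1 - a) * ((τ - p * π) + a * m * (1 - p)) := by ring
  have : 0 ≤ (1 - a) * ((τ - p * π) + a * m * (1 - p)) := by
    have := sub_nonneg.2 ha1; have := sub_nonneg.2 hp1; have := sub_nonneg.2 hk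
    positivity
  linarith

/-- **Apex-pendant edge at the port `v`, cell/real form** (mirror of `pendant_u_le`): `π′ = b + (1−b)π`, `p′ = p + m b`,
`τ′ = bp + (1−b)τ + m b`, `m′ = (1−b)m`; `E ≤ C` is preserved (`C ≥ 1`). [this work] -/
theorem pendant_v_le (C p π τ m b : ℝ) (hC : 1 ≤ C) (hp : 0 ≤ p) (hπ : 0 ≤ π) (hπ1 : π ≤ 1) (hm : 0 ≤ m)
    (hk : p * π ≤ τ) (hE : (τ - p * π) ^ 2 ≤ C * p * π * m) (hb0 : 0 ≤ b) (hb1 : b ≤ 1) :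
    (b * p + (1 - b) * τ + m * b - (b + (1 - b) * π) * (p + m * b)) ^ 2
      ≤ C * (b + (1 - b) * π) * (p + m * b) * ((1 - b) * m) := by
  have hE1 : (b - b * b) ^ 2 ≤ C * b * b * (1 - b) := by
    have h1 : (b - b * b) ^ 2 = b * b * (1 - b) * (1 - b) := by ring
    have h0 : 0 ≤ b * b * (1 - b) := by have := sub_nonneg.2 hb1; positivity
    have h2 : b * b * (1 - b) * (1 - b) ≤ b * b * (1 - b) * C :=
      mul_le_mul_of_nonneg_left (by linarith) h0
    rw [h1]; linarith
  exact series_real C b b b (1 - b) p π τ m hC hb0 hb0 hb1 (sub_nonneg.2 hb1) hp hπ hπ1 hm (by nlinarith) hk hE1 hE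

/-- Harris is kept by the apex-pendant step at `v`. [this work] -/
theorem pendant_v_harris (p π τ m b : ℝ) (hπ1 : π ≤ 1) (hm : 0 ≤ m) (hk : p * π ≤ τ) (hb0 : 0 ≤ b) (hb1 : b ≤ 1) :
    (b + (1 - b) * π) * (p + m * b) ≤ b * p + (1 - b) * τ + m * b := by
  have e : b * p + (1 - b) * τ + m * b - (b + (1 - b) * π) * (p + m * b) = (1 - b) * ((τ - p * π) + b * m * (1 - π)) := by ring
  have : 0 ≤ (1 - b) * ((τ - p * π) + b * m * (1 - π)) := by
    have := sub_nonneg.2 hb1; have := sub_nonneg.2 hπ1; have := sub_nonneg.2 hk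
    positivity
  linarith

/-- **`E ≤ 28/27` IS PRESERVED UNDER PARALLEL COMPOSITION WITH ANY HARRIS-TIGHT PIECE.**  Let `x = (x₀, B, A, m, τ)` be a valid
piece (cells `≥ 0`, sum `1`) with Harris `(τ+B)(τ+A) ≤ τ` and `E ≤ 28/27`, and let `y` be the general valid piece with `κ_y = 0`,
`y = ((1−a)(1−b)(1−w), a(1−b), (1−a)b, (1−a)(1−b)w, ab)` (`a = P_y(o↔u)`, `b = P_y(o↔v)` independent, `w = P_y(u↔v | o isolated)`;
`a, b, w ∈ [0,1]`).  Then the composite `z` (cells `z_B, z_A, z_m, z_τ` as in `comp_kappa_eq` with `y₀ = (1−a)(1−b)(1−w)`, …; `z₀` does not enter `E`) has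
`E ≤ 28/27`.  Proof: `z` differs from `((x ⊙ e_w) ⊙ e_{ou,a}) ⊙ e_{ov,b}` (`shortcut_cells_le`, `pendant_u_le`, `pendant_v_le`) by moving
the masses `w(1−a)b·(x₀+A)` and `wa(1−b)·(x₀+B)` from the all-joined cell to the cells `ov`, `ou`, which lowers `κ/p` and `κ/π` and keeps
`m`.  This is the `κ_y = 0` face of the two-sided problem U(28/27). [this work] -/
theorem harrisTight_comp_le (x0 B A m τ a b w zB zA zm zτ : ℝ)
    (h0 : 0 ≤ x0) (hB : 0 ≤ B) (hA : 0 ≤ A) (hm : 0 ≤ m) (hτ : 0 ≤ τ) (hsum : x0 + B + A + m + τ = 1)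
    (hH : (τ + B) * (τ + A) ≤ τ) (hE : (τ - (τ + B) * (τ + A)) ^ 2 ≤ 28 / 27 * ((τ + B) * (τ + A)) * m)
    (ha0 : 0 ≤ a) (ha1 : a ≤ 1) (hb0 : 0 ≤ b) (hb1 : b ≤ 1) (hw0 : 0 ≤ w) (hw1 : w ≤ 1)
    (hzB : zB = x0 * (a * (1 - b)) + B * ((1 - a) * (1 - b) * (1 - w)) + B * (a * (1 - b)))
    (hzA : zA = x0 * ((1 - a) * b) + A * ((1 - a) * (1 - b) * (1 - w)) + A * ((1 - a) * b))
    (hzm : zm = x0 * ((1 - a) * (1 - b) * w) + m * ((1 - a) * (1 - b) * (1 - w)) + m * ((1 - a) * (1 - b) * w))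
    (hzτ : zτ = τ * ((1 - a) * (1 - b) * (1 - w) + a * (1 - b) + (1 - a) * b + (1 - a) * (1 - b) * w + a * b)
        + (x0 + B + A + m) * (a * b) + B * ((1 - a) * b + (1 - a) * (1 - b) * w) + A * (a * (1 - b) + (1 - a) * (1 - b) * w)
        + m * (a * (1 - b) + (1 - a) * b)) :
    (zτ - (zτ + zB) * (zτ + zA)) ^ 2 ≤ 28 / 27 * ((zτ + zB) * (zτ + zA)) * zm := by
  have hC : (1 : ℝ) ≤ 28 / 27 := by norm_num
  have hx0 : x0 = 1 - B - A - m - τ := by linarith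
  have ha1' := sub_nonneg.2 ha1
  have hb1' := sub_nonneg.2 hb1
  have hw1' := sub_nonneg.2 hw1
  have hzτ0 : 0 ≤ zτ := by rw [hzτ]; positivity
  have hzB0 : 0 ≤ zB := by rw [hzB]; positivity
  have hzA0 : 0 ≤ zA := by rw [hzA]; positivity
  have hpz0 : 0 ≤ zτ + zB := add_nonneg hzτ0 hzB0
  have hπz0 : 0 ≤ zτ + zA := add_nonneg hzτ0 hzA0
  -- step 1: the shortcut x' = x ⊙ e_w (opaque names p', π', τ', m' for its data)
  have h1 := shortcut_cells_le x0 B A m τ w h0 hB hA hm hτ hsum hH hE hw0 hw1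
  obtain ⟨p', hp'⟩ : ∃ t : ℝ, t = τ + B + w * A := ⟨_, rfl⟩
  obtain ⟨π', hπ'⟩ : ∃ t : ℝ, t = τ + A + w * B := ⟨_, rfl⟩
  obtain ⟨τ', hτ'⟩ : ∃ t : ℝ, t = τ + w * (A + B) := ⟨_, rfl⟩
  obtain ⟨m', hm'⟩ : ∃ t : ℝ, t = m + w * x0 := ⟨_, rfl⟩
  have hp'0 : 0 ≤ p' := by rw [hp']; positivity
  have hπ'0 : 0 ≤ π' := by rw [hπ']; positivity
  have hm'0 : 0 ≤ m' := by rw [hm']; positivity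
  have hp'1 : p' + m' ≤ 1 := by rw [hp', hm']; linarith [mul_nonneg hw1' hA, mul_nonneg hw1' h0]
  have hπ'1 : π' + m' ≤ 1 := by rw [hπ', hm']; linarith [mul_nonneg hw1' hB, mul_nonneg hw1' h0]
  have hτp' : τ' ≤ p' := by rw [hτ', hp']; linarith [mul_nonneg hw1' hB]
  have hτπ' : τ' ≤ π' := by rw [hτ', hπ']; linarith [mul_nonneg hw1' hA]
  have hk1 : p' * π' ≤ τ' := by
    have e : τ' - p' * π' = (τ - (τ + B) * (τ + A)) + w * (A + B) * (x0 + m) + w * A * B * (2 - w) := by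
      rw [hτ', hp', hπ', hx0]; ring
    have : 0 ≤ w * (A + B) * (x0 + m) + w * A * B * (2 - w) := by
      have : 0 ≤ 2 - w := by linarith
      positivity
    linarith [sub_nonneg.2 hH]
  have hE1 : (τ' - p' * π') ^ 2 ≤ 28 / 27 * p' * π' * m' := by
    have e : 28 / 27 * p' * π' * m' = 28 / 27 * ((τ + B + w * A) * (τ + A + w * B)) * (m + w * x0) := by
      rw [hp', hπ', hm']; ring
    rw [e, hτ', hp', hπ']; exact h1
  clear h1 hE
  -- step 2: pendant apex edge at u (probability a)
  have h2 := pendant_u_le (28 / 27) p' π' τ' m' a hC hp'0 (by linarith) hπ'0 hm'0 hk1 hE1 ha0 ha1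
  have hk2' := pendant_u_harris p' π' τ' m' a (by linarith) hm'0 hk1 ha0 ha1
  obtain ⟨p'', hp''⟩ : ∃ t : ℝ, t = a + (1 - a) * p' := ⟨_, rfl⟩
  obtain ⟨π'', hπ''⟩ : ∃ t : ℝ, t = π' + m' * a := ⟨_, rfl⟩
  obtain ⟨τ'', hτ''⟩ : ∃ t : ℝ, t = a * π' + (1 - a) * τ' + m' * a := ⟨_, rfl⟩
  obtain ⟨m'', hm''⟩ : ∃ t : ℝ, t = (1 - a) * m' := ⟨_, rfl⟩
  have hp''0 : 0 ≤ p'' := by rw [hp'']; positivity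
  have hπ''0 : 0 ≤ π'' := by rw [hπ'']; positivity
  have hm''0 : 0 ≤ m'' := by rw [hm'']; positivity
  have hp''1 : p'' + m'' ≤ 1 := by
    rw [hp'', hm'']; linarith [mul_le_mul_of_nonneg_left hp'1 ha1']
  have hπ''1 : π'' ≤ 1 := by rw [hπ'']; linarith [mul_le_mul_of_nonneg_left ha1 hm'0]
  have hτp'' : τ'' ≤ p'' := by
    rw [hτ'', hp'']; linarith [mul_le_mul_of_nonneg_left hτp' ha1', mul_le_mul_of_nonneg_left hπ'1 ha0]
  have hτπ'' : τ'' ≤ π'' := by rw [hτ'', hπ'']; linarith [mul_le_mul_of_nonneg_left hτπ' ha1']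
  have hk2 : p'' * π'' ≤ τ'' := by rw [hp'', hπ'', hτ'']; exact hk2'
  have hE2 : (τ'' - p'' * π'') ^ 2 ≤ 28 / 27 * p'' * π'' * m'' := by rw [hτ'', hp'', hπ'', hm'']; exact h2
  clear h2 hE1
  -- step 3: pendant apex edge at v (probability b)
  have h3 := pendant_v_le (28 / 27) p'' π'' τ'' m'' b hC hp''0 hπ''0 hπ''1 hm''0 hk2 hE2 hb0 hb1
  have hk3' := pendant_v_harris p'' π'' τ'' m'' b hπ''1 hm''0 hk2 hb0 hb1
  obtain ⟨πs, hπs⟩ : ∃ t : ℝ, t = b + (1 - b) * π'' := ⟨_, rfl⟩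
  obtain ⟨ps, hps⟩ : ∃ t : ℝ, t = p'' + m'' * b := ⟨_, rfl⟩
  obtain ⟨τs, hτs⟩ : ∃ t : ℝ, t = b * p'' + (1 - b) * τ'' + m'' * b := ⟨_, rfl⟩
  obtain ⟨ms, hms⟩ : ∃ t : ℝ, t = (1 - b) * m'' := ⟨_, rfl⟩
  have hps0 : 0 ≤ ps := by rw [hps]; positivity
  have hπs0 : 0 ≤ πs := by rw [hπs]; positivity
  have hms0 : 0 ≤ ms := by rw [hms]; positivity
  have hps1 : ps ≤ 1 := by rw [hps]; linarith [mul_le_mul_of_nonneg_left hb1 hm''0]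
  have hπs1 : πs ≤ 1 := by rw [hπs]; linarith [mul_le_mul_of_nonneg_left hπ''1 hb1']
  have hτps : τs ≤ ps := by rw [hτs, hps]; linarith [mul_le_mul_of_nonneg_left hτp'' hb1']
  have hτπs : τs ≤ πs := by
    rw [hτs, hπs]; linarith [mul_le_mul_of_nonneg_left hp''1 hb0, mul_le_mul_of_nonneg_left hτπ'' hb1']
  have hκs0 : 0 ≤ τs - ps * πs := by
    have e : τs - ps * πs = (b * p'' + (1 - b) * τ'' + m'' * b) - (b + (1 - b) * π'') * (p'' + m'' * b) := by
      rw [hτs, hps, hπs]; ring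
    rw [e]; linarith only [hk3']
  have hE3 : (τs - ps * πs) ^ 2 ≤ 28 / 27 * (ps * πs) * ms := by
    have e1 : (τs - ps * πs) ^ 2 = (b * p'' + (1 - b) * τ'' + m'' * b - (b + (1 - b) * π'') * (p'' + m'' * b)) ^ 2 := by
      rw [hτs, hps, hπs]; ring
    have e2 : 28 / 27 * (ps * πs) * ms = 28 / 27 * (b + (1 - b) * π'') * (p'' + m'' * b) * ((1 - b) * m'') := by
      rw [hps, hπs, hms]; ring
    rw [e1, e2]; exact h3
  clear h3 hE2 hk3' hk2' hk2 hk1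
  -- step 4: the composite is the series piece `(ps, πs, τs, ms)` with two mass moves θ₁U, θ₂W from the all-joined cell
  obtain ⟨U, hU⟩ : ∃ t : ℝ, t = x0 + A := ⟨_, rfl⟩
  obtain ⟨W, hW⟩ : ∃ t : ℝ, t = x0 + B := ⟨_, rfl⟩
  obtain ⟨θ₁, hθ₁⟩ : ∃ t : ℝ, t = w * ((1 - a) * b) := ⟨_, rfl⟩
  obtain ⟨θ₂, hθ₂⟩ : ∃ t : ℝ, t = w * (a * (1 - b)) := ⟨_, rfl⟩
  have hU0 : 0 ≤ U := by rw [hU]; positivity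
  have hW0 : 0 ≤ W := by rw [hW]; positivity
  have hθ₁0 : 0 ≤ θ₁ := by rw [hθ₁]; positivity
  have hθ₂0 : 0 ≤ θ₂ := by rw [hθ₂]; positivity
  have ep : zτ + zB = ps - θ₁ * U := by
    rw [hzτ, hzB, hps, hp'', hm'', hp', hm', hθ₁, hU, hx0]; ring
  have eπ : zτ + zA = πs - θ₂ * W := by
    rw [hzτ, hzA, hπs, hπ'', hπ', hm', hθ₂, hW, hx0]; ring
  have em : zm = ms := by
    rw [hzm, hms, hm'', hm', hx0]; ring
  have eτ : zτ = τs - θ₁ * U - θ₂ * W := by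
    rw [hzτ, hτs, hp'', hτ'', hm'', hp', hπ', hτ', hm', hθ₁, hθ₂, hU, hW, hx0]; ring
  have eκ : zτ - (zτ + zB) * (zτ + zA)
      = (τs - ps * πs) - θ₁ * U * (1 - πs) - θ₂ * W * (1 - ps) - θ₁ * θ₂ * U * W := by
    rw [ep, eπ]; rw [eτ]; ring
  -- Harris of the composite (cell level)
  have hκz : 0 ≤ zτ - (zτ + zB) * (zτ + zA) := by
    have hc := comp_harris x0 B A m τ ((1 - a) * (1 - b) * (1 - w)) (a * (1 - b)) ((1 - a) * b) ((1 - a) * (1 - b) * w) (a * b)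
      h0 hB hA hm hτ (by positivity) (by positivity) (by positivity) (by positivity) (by positivity)
      (by have e : (x0 + m) * τ - A * B = τ - (τ + B) * (τ + A) := by rw [hx0]; ring
          rw [e]; linarith [hH])
      (by have e : ((1 - a) * (1 - b) * (1 - w) + (1 - a) * (1 - b) * w) * (a * b) - (1 - a) * b * (a * (1 - b)) = 0 := by ring
          rw [e])
    have e : zτ - (zτ + zB) * (zτ + zA)
        = (x0 * ((1 - a) * (1 - b) * (1 - w)) + (x0 * ((1 - a) * (1 - b) * w) + m * ((1 - a) * (1 - b) * (1 - w))
            + m * ((1 - a) * (1 - b) * w)))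
          * (τ * ((1 - a) * (1 - b) * (1 - w) + a * (1 - b) + (1 - a) * b + (1 - a) * (1 - b) * w + a * b)
            + (x0 + B + A + m) * (a * b) + B * ((1 - a) * b + (1 - a) * (1 - b) * w)
            + A * (a * (1 - b) + (1 - a) * (1 - b) * w) + m * (a * (1 - b) + (1 - a) * b))
          - (x0 * ((1 - a) * b) + A * ((1 - a) * (1 - b) * (1 - w)) + A * ((1 - a) * b))
            * (x0 * (a * (1 - b)) + B * ((1 - a) * (1 - b) * (1 - w)) + B * (a * (1 - b))) := by
      rw [hzτ, hzB, hzA, hx0]; ring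
    rw [e]; exact hc
  -- step 5: κ_z/p_z ≤ κ_s/p_s and κ_z/π_z ≤ κ_s/π_s
  obtain ⟨κs, hκs⟩ : ∃ t : ℝ, t = τs - ps * πs := ⟨_, rfl⟩
  obtain ⟨κz, hκz'⟩ : ∃ t : ℝ, t = zτ - (zτ + zB) * (zτ + zA) := ⟨_, rfl⟩
  rw [← hκs] at hκs0 hE3
  rw [← hκz'] at hκz ⊢
  have eκ' : κz = κs - θ₁ * U * (1 - πs) - θ₂ * W * (1 - ps) - θ₁ * θ₂ * U * W := by rw [hκz', hκs]; exact eκ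
  have hA' : κz * ps ≤ κs * (zτ + zB) := by
    have e : κs * (zτ + zB) - κz * ps = θ₁ * U * (ps - τs) + θ₂ * W * ps * (1 - ps) + θ₁ * θ₂ * U * W * ps := by
      rw [eκ', ep, hκs]; ring
    have : 0 ≤ θ₁ * U * (ps - τs) + θ₂ * W * ps * (1 - ps) + θ₁ * θ₂ * U * W * ps := by
      have := sub_nonneg.2 hτps; have := sub_nonneg.2 hps1; positivity
    linarith
  have hB' : κz * πs ≤ κs * (zτ + zA) := by
    have e : κs * (zτ + zA) - κz * πs = θ₂ * W * (πs - τs) + θ₁ * U * πs * (1 - πs) + θ₁ * θ₂ * U * W * πs := by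
      rw [eκ', eπ, hκs]; ring
    have : 0 ≤ θ₂ * W * (πs - τs) + θ₁ * U * πs * (1 - πs) + θ₁ * θ₂ * U * W * πs := by
      have := sub_nonneg.2 hτπs; have := sub_nonneg.2 hπs1; positivity
    linarith
  -- step 6: assemble
  have hprod : (κz * ps) * (κz * πs) ≤ (κs * (zτ + zB)) * (κs * (zτ + zA)) :=
    mul_le_mul hA' hB' (mul_nonneg hκz hπs0) (le_trans (mul_nonneg hκz hps0) hA')
  rw [em]
  rcases (mul_nonneg hps0 hπs0).eq_or_lt with hzero | hpos
  · -- degenerate: ps πs = 0 ⟹ κs = 0 ⟹ a port probability of z vanishes ⟹ κz = 0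
    have hκs2 : κs ^ 2 ≤ 0 := by
      have h := hE3; rw [← hzero] at h; simpa using h
    have hκsz : κs = 0 := (pow_eq_zero_iff two_ne_zero).mp (le_antisymm hκs2 (sq_nonneg _))
    rw [hκsz, zero_mul] at hA' hB'
    have hκz0 : κz = 0 := by
      rcases mul_eq_zero.mp hzero.symm with hp0 | hq0
      · have hpz : zτ + zB ≤ 0 := by rw [ep, hp0]; linarith [mul_nonneg hθ₁0 hU0]
        have hzτz : zτ = 0 := by linarith
        have hzBz : zB = 0 := by linarith
        rw [hκz', hzτz, hzBz]; ring
      · have hπz : zτ + zA ≤ 0 := by rw [eπ, hq0]; linarith [mul_nonneg hθ₂0 hW0]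
        have hzτz : zτ = 0 := by linarith
        have hzAz : zA = 0 := by linarith
        rw [hκz', hzτz, hzAz]; ring
    rw [hκz0]
    have : 0 ≤ 28 / 27 * ((zτ + zB) * (zτ + zA)) * ms := by positivity
    simpa using this
  · have h4 : κz ^ 2 * (ps * πs) ≤ κs ^ 2 * ((zτ + zB) * (zτ + zA)) := by
      calc κz ^ 2 * (ps * πs) = (κz * ps) * (κz * πs) := by ring
        _ ≤ (κs * (zτ + zB)) * (κs * (zτ + zA)) := hprod
        _ = κs ^ 2 * ((zτ + zB) * (zτ + zA)) := by ring
    have h5 : κs ^ 2 * ((zτ + zB) * (zτ + zA)) ≤ 28 / 27 * (ps * πs) * ms * ((zτ + zB) * (zτ + zA)) :=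
      mul_le_mul_of_nonneg_right hE3 (mul_nonneg hpz0 hπz0)
    have h6 : κz ^ 2 * (ps * πs) ≤ (28 / 27 * ((zτ + zB) * (zτ + zA)) * ms) * (ps * πs) := by
      calc κz ^ 2 * (ps * πs) ≤ κs ^ 2 * ((zτ + zB) * (zτ + zA)) := h4
        _ ≤ 28 / 27 * (ps * πs) * ms * ((zτ + zB) * (zτ + zA)) := h5
        _ = (28 / 27 * ((zτ + zB) * (zτ + zA)) * ms) * (ps * πs) := by ring
    exact le_of_mul_le_mul_right h6 hpos

end APL

end Summit.CriticalPhenomena.PercolationContinuityZ3.Theorems
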